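import Mathlib

/-!
# The top of the spectrum of a self-adjoint operator above its essential bound

Topic `Literature/Analysis/OperatorTheory`. A quantitative, functional-calculus form of the classical
fact that a self-adjoint bounded operator `A = C + B` on a Hilbert space with `C` compact has only
discrete spectrum of finite multiplicity above `sup σ_ess(A) ≤ sup W(B)` (H. Weyl 1909; Reed–Simon IV,
§XIII.4, Theorem XIII.14 "Weyl's essential spectrum theorem" and its Corollary 2, PDF pp. 113–115 of
the held copy): if
`Re ⟪(A - C) f, f⟫ ≤ β ‖f‖²` for all `f` and `ε > 0`, then there is a **finite-dimensional**
subspace `W` (the closure of the range of `φ(A)` for a continuous cut-off `φ` vanishing below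
`β + ε` and equal to `1` above `β + 2ε`), invariant under every bounded operator commuting with
`A`, on which `Re ⟪A w, w⟫ ≥ (β + ε)‖w‖²`, and such that `Re ⟪A f, f⟫ ≤ (β + 2ε)‖f‖²` on `Wᗮ`
(`exists_finiteDimensional_invariant_top`). No spectral projections are needed: only Mathlib's
continuous functional calculus on the C⋆-algebra `H →L[ℂ] H` with its Loewner order
(`cfc_mono`, `cfc_nonneg`, `Commute.cfc_real`), Bessel's inequality, and the relative compactness
of the image of the unit ball under `C`.

Consumed by the Eisenstein-free proof of Iwaniec's pretrace estimate (12.5)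
(`Literature.NumberTheory.Automorphic.Iwaniec2002_eq_12_5`): applied to an invariant integral
operator `T_k` on `L²(Γ\ℍ) ⊖ (small eigenfunctions)` it shows that the top of the spectrum of
`T_k` there does not exceed `sup_{t ∈ ℝ} h_k(t)`.

Everything here is proved; there are no definitions besides the cut-off `topCutoff`.

## References
* M. Reed, B. Simon, *Methods of Modern Mathematical Physics IV: Analysis of Operators*, Academic
  Press 1978, §XIII.4, Thm XIII.14 (Weyl's essential spectrum theorem) and Corollary 2; notes to
  §XIII.4 (H. Weyl, Rend. Circ. Mat. Palermo 27 (1909)); held copy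
  `book:reednd-methods-modern-mathematical-physics-volume-iv-analysis`, PDF pp. 113–115, 313.
  [ReedSimonIV1978]
* M. Reed, B. Simon, *Methods of Modern Mathematical Physics I: Functional Analysis*, rev. ed. 1980,
  §VI.5 (compact operators; Riesz–Schauder theory). [ReedSimonI1980]
-/

noncomputable section

open Filter Topology Submodule
open scoped InnerProductSpace ComplexOrder NNReal InnerProduct

namespace Literature.Analysis.OperatorTheory

variable {H : Type*} [NormedAddCommGroup H] [InnerProductSpace ℂ H]

local notation "⟪" x ", " y "⟫" => @inner ℂ _ _ x y

/-! ## 1. Orthonormal sequences and compact operators -/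

section Orthonormal

/-- **An infinite-dimensional Hilbert space contains an orthonormal sequence** (a Hilbert basis is
indexed by an infinite set). [folklore] -/
theorem exists_orthonormal_nat_of_not_finiteDimensional {E : Type*} [NormedAddCommGroup E]
    [InnerProductSpace ℂ E] [CompleteSpace E] (h : ¬ FiniteDimensional ℂ E) :
    ∃ e : ℕ → E, Orthonormal ℂ e := by
  obtain ⟨w, b, hb⟩ := exists_hilbertBasis ℂ E
  by_cases hw : w.Finite
  · haveI : Fintype w := hw.fintype
    exact absurd (Module.Finite.of_basis b.toOrthonormalBasis.toBasis) h
  · haveI : Infinite w := Set.infinite_coe_iff.mpr hw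
    exact ⟨fun n => b (Infinite.natEmbedding w n),
      b.orthonormal.comp _ (Infinite.natEmbedding w).injective⟩

/-- **Bessel**: the Fourier coefficients of a fixed vector along an orthonormal sequence tend to
zero. [folklore] -/
theorem tendsto_inner_atTop_of_orthonormal {e : ℕ → H} (he : Orthonormal ℂ e) (y : H) :
    Tendsto (fun n => ⟪e n, y⟫) atTop (𝓝 0) := by
  have hs : Summable fun n => ‖⟪e n, y⟫‖ ^ 2 := he.inner_products_summable y
  have h0 : Tendsto (fun n => ‖⟪e n, y⟫‖ ^ 2) atTop (𝓝 0) := hs.tendsto_atTop_zero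
  rw [tendsto_zero_iff_norm_tendsto_zero]
  have h1 : Tendsto (fun n => Real.sqrt (‖⟪e n, y⟫‖ ^ 2)) atTop (𝓝 (Real.sqrt 0)) :=
    (Real.continuous_sqrt.tendsto 0).comp h0
  rw [Real.sqrt_zero] at h1
  refine h1.congr fun n => ?_
  rw [Real.sqrt_sq (norm_nonneg _)]

variable [CompleteSpace H]

/-- **A compact operator sends orthonormal sequences to null sequences.** If not, a subsequence of
`C e_n` converges to some `y ≠ 0` (relative compactness of `C(ball)`), while
`⟪C e_n, y⟫ = ⟪e_n, C† y⟫ → 0` by Bessel's inequality. [cite: ReedSimonI1980, §VI.5] -/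
theorem tendsto_norm_apply_orthonormal_of_isCompactOperator {C : H →L[ℂ] H}
    (hC : IsCompactOperator C) {e : ℕ → H} (he : Orthonormal ℂ e) :
    Tendsto (fun n => ‖C (e n)‖) atTop (𝓝 0) := by
  rw [Metric.tendsto_atTop]
  by_contra hnot
  push Not at hnot
  obtain ⟨δ, hδ, hfreq⟩ := hnot
  -- a subsequence with `‖C e‖ ≥ δ`
  have hfr : ∃ᶠ n in atTop, δ ≤ ‖C (e n)‖ := by
    rw [frequently_atTop]
    intro N
    obtain ⟨n, hn, hδn⟩ := hfreq N
    refine ⟨n, hn, ?_⟩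
    simpa [Real.dist_eq, abs_of_nonneg (norm_nonneg _)] using hδn
  obtain ⟨φ, hφ, hφδ⟩ := extraction_of_frequently_atTop hfr
  -- relative compactness of `C` of the unit ball
  set K := closure (C '' Metric.closedBall (0 : H) 1) with hK
  have hKc : IsCompact K := hC.isCompact_closure_image_closedBall 1
  have hmem : ∀ n, C (e (φ n)) ∈ K := fun n =>
    subset_closure ⟨e (φ n), by simp [Metric.mem_closedBall, he.norm_eq_one], rfl⟩
  obtain ⟨y, -, ψ, hψ, hlim⟩ := hKc.tendsto_subseq hmem
  -- `‖y‖ ≥ δ`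
  have hy : δ ≤ ‖y‖ := by
    have h1 : Tendsto (fun n => ‖C (e (φ (ψ n)))‖) atTop (𝓝 ‖y‖) := (continuous_norm.tendsto y).comp hlim
    exact ge_of_tendsto h1 (Eventually.of_forall fun n => hφδ (ψ n))
  -- `⟪C e_{φ ψ n}, y⟫ → ‖y‖²` and `→ 0`
  have hA : Tendsto (fun n => ⟪C (e (φ (ψ n))), y⟫) atTop (𝓝 ⟪y, y⟫) :=
    (continuous_inner.tendsto (y, y)).comp (hlim.prodMk_nhds tendsto_const_nhds)
  have hB : Tendsto (fun n => ⟪C (e (φ (ψ n))), y⟫) atTop (𝓝 0) := by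
    have h0 := (tendsto_inner_atTop_of_orthonormal he (ContinuousLinearMap.adjoint C y)).comp
      ((hφ.comp hψ).tendsto_atTop)
    refine h0.congr fun n => ?_
    simp only [Function.comp_apply]
    rw [ContinuousLinearMap.adjoint_inner_right]
  have heq : ⟪y, y⟫ = 0 := tendsto_nhds_unique hA hB
  rw [inner_self_eq_zero] at heq
  rw [heq, norm_zero] at hy
  linarith

end Orthonormal

/-! ## 2. Quadratic forms and the Loewner order -/

section Forms

/-- `0 ≤ B` in the Loewner order gives `0 ≤ Re ⟪B f, f⟫`. [folklore] -/
theorem re_inner_nonneg_of_loewner_nonneg {B : H →L[ℂ] H} (hB : 0 ≤ B) (f : H) :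
    0 ≤ (⟪B f, f⟫).re :=
  ((ContinuousLinearMap.nonneg_iff_isPositive B).mp hB).re_inner_nonneg_left f

/-- `X ≤ Y` in the Loewner order gives `Re ⟪X f, f⟫ ≤ Re ⟪Y f, f⟫`. [folklore] -/
theorem re_inner_le_of_loewner_le {X Y : H →L[ℂ] H} (h : X ≤ Y) (f : H) :
    (⟪X f, f⟫).re ≤ (⟪Y f, f⟫).re := by
  have h1 : 0 ≤ (⟪(Y - X) f, f⟫).re := by
    rw [ContinuousLinearMap.le_def] at h
    exact h.re_inner_nonneg_left f
  rw [sub_apply, inner_sub_left, Complex.sub_re] at h1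
  linarith

/-- `Re ⟪(r • 1) f, f⟫ = r ‖f‖²` for the real scalar action on `H →L[ℂ] H`. [folklore] -/
theorem re_inner_algebraMap_apply (r : ℝ) (f : H) :
    (⟪(algebraMap ℝ (H →L[ℂ] H) r) f, f⟫).re = r * ‖f‖ ^ 2 := by
  rw [Algebra.algebraMap_eq_smul_one, smul_apply, one_apply_eq_self,
    RCLike.real_smul_eq_coe_smul (K := ℂ), inner_smul_left, inner_self_eq_norm_sq_to_K]
  simp only [Complex.coe_algebraMap, Complex.conj_ofReal]
  rw [show ((r : ℂ) * ((‖f‖ : ℂ) ^ 2)) = (((r * ‖f‖ ^ 2 : ℝ)) : ℂ) by push_cast; ring]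
  exact Complex.ofReal_re _

/-- `Re ⟪(A - r) f, f⟫ = Re ⟪A f, f⟫ - r ‖f‖²`. [folklore] -/
theorem re_inner_sub_algebraMap_apply (A : H →L[ℂ] H) (r : ℝ) (f : H) :
    (⟪(A - algebraMap ℝ (H →L[ℂ] H) r) f, f⟫).re = (⟪A f, f⟫).re - r * ‖f‖ ^ 2 := by
  rw [sub_apply, inner_sub_left, Complex.sub_re, re_inner_algebraMap_apply]

/-- `|Re ⟪C f, f⟫| ≤ ‖C f‖ ‖f‖`. [folklore] -/
theorem re_inner_le_norm_mul (C : H →L[ℂ] H) (f : H) : (⟪C f, f⟫).re ≤ ‖C f‖ * ‖f‖ :=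
  (Complex.re_le_norm _).trans (norm_inner_le_norm _ _)

end Forms

/-! ## 3. The cut-off and the top part -/

section Top

/-- The continuous cut-off `φ(x) = min(1, max(0, (x - c)/ε))`: `0` on `(-∞, c]`, `1` on
`[c + ε, ∞)`, values in `[0, 1]`. [folklore] -/
def topCutoff (c ε : ℝ) (x : ℝ) : ℝ := min 1 (max 0 ((x - c) / ε))

/-- The cut-off is continuous. [folklore] -/
theorem continuous_topCutoff (c ε : ℝ) : Continuous (topCutoff c ε) := by
  unfold topCutoff; fun_prop

/-- The cut-off is non-negative. [folklore] -/
theorem topCutoff_nonneg (c ε x : ℝ) : 0 ≤ topCutoff c ε x :=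
  le_min zero_le_one (le_max_left _ _)

/-- The cut-off is at most `1`. [folklore] -/
theorem topCutoff_le_one (c ε x : ℝ) : topCutoff c ε x ≤ 1 := min_le_left _ _

/-- The cut-off vanishes on `(-∞, c]`. [folklore] -/
theorem topCutoff_eq_zero {c ε x : ℝ} (hε : 0 < ε) (hx : x ≤ c) : topCutoff c ε x = 0 := by
  unfold topCutoff
  have : (x - c) / ε ≤ 0 := div_nonpos_of_nonpos_of_nonneg (by linarith) hε.le
  rw [max_eq_left this, min_eq_right zero_le_one]

/-- The cut-off equals `1` on `[c + ε, ∞)`. [folklore] -/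
theorem topCutoff_eq_one {c ε x : ℝ} (hε : 0 < ε) (hx : c + ε ≤ x) : topCutoff c ε x = 1 := by
  unfold topCutoff
  have : 1 ≤ (x - c) / ε := by rw [le_div_iff₀ hε]; linarith
  rw [min_eq_left (le_max_of_le_right this)]

variable [CompleteSpace H]

/-- **The top of the spectrum above the essential bound is finite-dimensional and splits off.**
Let `A` be a bounded self-adjoint operator on a complex Hilbert space, `C` a compact operator with
`Re ⟪(A - C) f, f⟫ ≤ β ‖f‖²` for all `f`, and `ε > 0`. Then there is a finite-dimensional subspace
`W` such that (i) `T W ⊆ W` for every bounded `T` commuting with `A`; (ii)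
`Re ⟪A w, w⟫ ≥ (β + ε) ‖w‖²` for `w ∈ W`; (iii) `Re ⟪A f, f⟫ ≤ (β + 2ε) ‖f‖²` for `f ∈ Wᗮ`.
(`W` is the closure of the range of `φ(A)`, `φ = topCutoff (β + ε) ε`; (ii) because
`φ(A)(A - β - ε)φ(A) = (φ²·(x - β - ε))(A) ≥ 0`; finite-dimensionality because an orthonormal
sequence `e_n` in `W` would have `Re ⟪C e_n, e_n⟫ ≥ ε` while `C e_n → 0`; (iii) because on
`ker φ(A) ⊇ Wᗮ` one has `A - β - 2ε ≤ (x - β - 2ε)₊(A) ≤ M φ(A)`.)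
[cite: ReedSimonIV1978, §XIII.4, Thm XIII.14 & Cor. 2, PDF pp. 113–115] -/
theorem exists_finiteDimensional_invariant_top {A C : H →L[ℂ] H} (hA : IsSelfAdjoint A)
    (hC : IsCompactOperator C) {β ε : ℝ} (hε : 0 < ε)
    (hB : ∀ f : H, (⟪(A - C) f, f⟫).re ≤ β * ‖f‖ ^ 2) :
    ∃ W : Submodule ℂ H, FiniteDimensional ℂ W ∧
      (∀ T : H →L[ℂ] H, Commute T A → ∀ w ∈ W, T w ∈ W) ∧
      (∀ w ∈ W, (β + ε) * ‖w‖ ^ 2 ≤ (⟪A w, w⟫).re) ∧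
      (∀ f ∈ Wᗮ, (⟪A f, f⟫).re ≤ (β + 2 * ε) * ‖f‖ ^ 2) := by
  set c : ℝ := β + ε with hc
  set φ : ℝ → ℝ := topCutoff c ε with hφ
  have hφc : Continuous φ := continuous_topCutoff c ε
  set P : H →L[ℂ] H := cfc φ A with hP
  have hPsa : IsSelfAdjoint P := cfc_predicate φ A
  have hPsym : (P : H →ₗ[ℂ] H).IsSymmetric := hPsa.isSymmetric
  have hs : ∀ x y : H, ⟪P x, y⟫ = ⟪x, P y⟫ := fun x y => hPsym x y
  set W : Submodule ℂ H := (LinearMap.range (P : H →ₗ[ℂ] H)).topologicalClosure with hW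
  have hWc : IsClosed (W : Set H) := Submodule.isClosed_topologicalClosure _
  -- (ii) on the range of `P`, then on its closure
  have hQ : 0 ≤ P * (A - algebraMap ℝ (H →L[ℂ] H) c) * P := by
    have e1 : cfc (fun x : ℝ => x - c) A = A - algebraMap ℝ (H →L[ℂ] H) c := by
      rw [cfc_sub _ _ A, cfc_id' ℝ A, cfc_const c A]
    have e2 : P * (A - algebraMap ℝ (H →L[ℂ] H) c) * P =
        cfc (fun x : ℝ => (φ x * (x - c)) * φ x) A := by
      rw [cfc_mul (fun x => φ x * (x - c)) φ A (by fun_prop) hφc.continuousOn,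
        cfc_mul φ (fun x => x - c) A hφc.continuousOn (by fun_prop), e1, hP]
    rw [e2]
    refine cfc_nonneg fun x _ => ?_
    by_cases hx : x ≤ c
    · rw [hφ, topCutoff_eq_zero hε hx]; simp
    · push Not at hx
      have h0 := topCutoff_nonneg c ε x
      have : 0 ≤ x - c := by linarith
      rw [hφ]
      positivity
  have hrange : ∀ v : H, c * ‖P v‖ ^ 2 ≤ (⟪A (P v), P v⟫).re := by
    intro v
    have h1 := re_inner_nonneg_of_loewner_nonneg hQ v
    have e : (P * (A - algebraMap ℝ (H →L[ℂ] H) c) * P) v =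
        P ((A - algebraMap ℝ (H →L[ℂ] H) c) (P v)) := rfl
    rw [e, hs, re_inner_sub_algebraMap_apply] at h1
    linarith
  have hii : ∀ w ∈ W, c * ‖w‖ ^ 2 ≤ (⟪A w, w⟫).re := by
    intro w hw
    have hwc : w ∈ closure ((LinearMap.range (P : H →ₗ[ℂ] H) : Submodule ℂ H) : Set H) := by
      rw [← Submodule.topologicalClosure_coe]; exact hw
    have hS : IsClosed {w : H | c * ‖w‖ ^ 2 ≤ (⟪A w, w⟫).re} := by
      apply isClosed_le
      · fun_prop
      · exact Complex.continuous_re.comp (continuous_inner.comp (A.continuous.prodMk continuous_id))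
    refine closure_minimal ?_ hS hwc
    rintro _ ⟨v, rfl⟩
    exact hrange v
  -- (i) finite-dimensionality
  haveI : CompleteSpace W := hWc.completeSpace_coe
  have hfd : FiniteDimensional ℂ W := by
    by_contra hnfd
    obtain ⟨e, he⟩ := exists_orthonormal_nat_of_not_finiteDimensional hnfd
    set e' : ℕ → H := fun n => (e n : H) with he'
    have he' : Orthonormal ℂ e' := W.subtypeₗᵢ.orthonormal_comp_iff.mpr he
    have hlow : ∀ n, ε ≤ ‖C (e' n)‖ := by
      intro n
      have hn1 : ‖e' n‖ = 1 := he'.norm_eq_one n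
      have h1 := hii (e' n) (e n).2
      have h2 := hB (e' n)
      rw [sub_apply, inner_sub_left, Complex.sub_re] at h2
      have h3 := re_inner_le_norm_mul C (e' n)
      rw [hn1] at h1 h2 h3
      rw [hc] at h1
      nlinarith
    have hlim := tendsto_norm_apply_orthonormal_of_isCompactOperator hC he'
    have := ge_of_tendsto hlim (Eventually.of_forall hlow)
    linarith
  refine ⟨W, hfd, ?_, fun w hw => hii w hw, ?_⟩
  · -- invariance under the commutant of `A`
    intro T hT w hw
    have hPT : Commute P T := by
      rw [hP]; exact (hT.symm).cfc_real φ
    have hwc : w ∈ closure ((LinearMap.range (P : H →ₗ[ℂ] H) : Submodule ℂ H) : Set H) := by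
      rw [← Submodule.topologicalClosure_coe]; exact hw
    have himg : T w ∈ closure (T '' ((LinearMap.range (P : H →ₗ[ℂ] H) : Submodule ℂ H) : Set H)) :=
      map_mem_closure T.continuous hwc fun x hx => Set.mem_image_of_mem _ hx
    have hsub : T '' ((LinearMap.range (P : H →ₗ[ℂ] H) : Submodule ℂ H) : Set H) ⊆
        ((LinearMap.range (P : H →ₗ[ℂ] H) : Submodule ℂ H) : Set H) := by
      rintro _ ⟨_, ⟨v, rfl⟩, rfl⟩
      refine ⟨T v, ?_⟩
      change P (T v) = T (P v)
      have := congrArg (fun S : H →L[ℂ] H => S v) hPT.eq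
      simpa using this
    have : T w ∈ closure (((LinearMap.range (P : H →ₗ[ℂ] H) : Submodule ℂ H) : Set H)) :=
      closure_mono hsub himg
    change T w ∈ (W : Set H)
    rw [hW, Submodule.topologicalClosure_coe]
    exact this
  · -- (iii) on `Wᗮ ⊆ ker P`
    intro f hf
    have hPf : P f = 0 := by
      have hf' : f ∈ (LinearMap.range (P : H →ₗ[ℂ] H))ᗮ :=
        Submodule.orthogonal_le (Submodule.le_topologicalClosure _) hf
      have h1 : ⟪P f, P f⟫ = 0 := by
        rw [← hs]
        exact (Submodule.mem_orthogonal _ _).mp hf' _ ⟨P f, rfl⟩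
      exact inner_self_eq_zero.mp h1
    set c' : ℝ := β + 2 * ε with hc'
    set ψ : ℝ → ℝ := fun x => max 0 (x - c') with hψ
    have hψc : Continuous ψ := by fun_prop
    -- a bound for `ψ` on the (compact) spectrum
    obtain ⟨M₀, hM₀⟩ := (ContinuousFunctionalCalculus.isCompact_spectrum (R := ℝ) A).bddAbove_image
      hψc.continuousOn
    set M : ℝ := max M₀ 0 with hM
    have hM0 : 0 ≤ M := le_max_right _ _
    have hψM : ∀ x ∈ spectrum ℝ A, ψ x ≤ M * φ x := by
      intro x hx
      by_cases hxc : c' ≤ x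
      · have hφ1 : φ x = 1 := by rw [hφ]; exact topCutoff_eq_one hε (by rw [hc, hc'] at *; linarith)
        rw [hφ1, mul_one]
        exact (hM₀ ⟨x, hx, rfl⟩).trans (le_max_left _ _)
      · push Not at hxc
        have hψ0 : ψ x = 0 := by rw [hψ]; exact max_eq_left (by linarith)
        rw [hψ0]
        exact mul_nonneg hM0 (topCutoff_nonneg c ε x)
    have hle1 : A - algebraMap ℝ (H →L[ℂ] H) c' ≤ cfc ψ A := by
      have e : cfc (fun x : ℝ => x - c') A = A - algebraMap ℝ (H →L[ℂ] H) c' := by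
        rw [cfc_sub _ _ A, cfc_id' ℝ A, cfc_const c' A]
      rw [← e]
      exact cfc_mono (f := fun x : ℝ => x - c') (g := ψ) (a := A) (fun x _ => le_max_right _ _)
        (hf := by fun_prop) (hg := hψc.continuousOn)
    have hle2 : cfc ψ A ≤ M • P := by
      rw [hP, ← cfc_const_mul M φ A hφc.continuousOn]
      exact cfc_mono (f := ψ) (g := fun x => M * φ x) (a := A) hψM (hf := hψc.continuousOn)
        (hg := (continuous_const.mul hφc).continuousOn)
    have h1 := re_inner_le_of_loewner_le (hle1.trans hle2) f
    rw [re_inner_sub_algebraMap_apply, smul_apply, hPf, smul_zero,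
      inner_zero_left, Complex.zero_re] at h1
    linarith

end Top

end Literature.Analysis.OperatorTheory

end
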